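import Summits.QuantumFields.YangMills.Theorems.BalabanUVNodesN05SubBP2DK2PerKappaSlotExistsOfGuardedSockets
import Literature.MathematicalPhysics.QuantumFieldTheory.Balaban1983to89.B8Prop5NestedServerSrcPer
import Literature.MathematicalPhysics.QuantumFieldTheory.Balaban1983to89.B8SockWindowsSrc
import Literature.MathematicalPhysics.QuantumFieldTheory.Balaban1983to89.B8SockP5uEProviderGamma

/-!
# BalabanUVNodes ∕ N05 ([Balaban1985RegularSpaces] Prop. 5 (1.107)–(1.109) p. 94, Thm 4 p. 88 + p. 95, Thm 8 (1.146) p. 101, p. 77 «Ω_j ⊂ T_η», §3 p. 98):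
# THE SOURCED EXISTENCE SOCKETS `SP5base ∕ SP5` OF (10)′ `exists_residB8_slot8κ'_of_guardedSockets_at` SERVED BY NAME at the print-class periodic index
# `IdxB8SubDPerκ θ P Mκ Rκ` from lit-balaban's IR-N05-P5NS instance-(ii) server `B8Prop5NestedServerSrcPer` — index laws discharged, thresholds ∃-outer
# (WORK-SPLIT-2 dag-n05-c ∕ dag-n05-d; director-ym №227 (b) «GUARDED REQUIRED», №230 (B))

Track A of `YM-PLAN.md` (cell `pub-ymgap`, HUMAN RULING D-0062), node **N05**; seat `pub-ymgap-dag-n05-c` (g18), 2026-08-28; bears on K1⁹ `stmt-QuantumFields-27364`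
(`--supports … --as helper`, count-neutral).  WORK-SPLIT-2 with dag-n05-d g15 (pub-ymgap INBOX I.42831 ∕ I.42849 ∕ I.42871): dag-n05-d feeds (10)′ A's
`SB9srcH2Per ∕ hP3 ∕ SH59src` from N06's periodic binders (editions (13)′α ∕ γ) and `SP5u ∕ p5ePer ∕ p5uPer` from lit-balaban's IR-N05-P5NS servers ((13)′β);
THIS FILE serves the two remaining Theorem-4-frame sockets `SP5base ∕ SP5` — Proposition 5's EXISTENCE at Theorem 8's SOURCED gauge condition — so that the final
head of the guarded κ-periodic road displays only N06's analytic binders, [4]'s letters, constants and `hP6`.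

[Balaban1985RegularSpaces] = T. Bałaban, *Spaces of regular gauge field configurations on a lattice and gauge fixing conditions*, CMP **99** (1985) 75–102:
Prop. 5 (1.107)–(1.109) p. 94 («There exist positive constants c₂, c₃, depending on d and L only …»), Thm 4 p. 88 («there exists a constant c₁») + p. 89 + p. 95,
(1.68)–(1.69) p. 88, Thm 8 (1.146) p. 101, (1.57)–(1.59) p. 86, (1.3)–(1.6) p. 77 («Ω_j ⊂ T_η … we admit the case when some domains Ω_j are equal to T_η»),
§3 p. 98.  [Balaban1985BackgroundPropagators] Thm 3.1 p. 397, Thm 3.3 p. 399, (3.19) p. 393.  [Balaban1985Averaging] (4) p. 18 (the torus as periodic data), Prop. 4 p. 38.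

WHAT (by-name instantiation; no estimate, no definition).  (10)′ A `BalabanUVNodesN05SubBP2DK2PerKappaSlotExistsOfGuardedSockets.exists_residB8_slot8κ'_of_guardedSockets_at`
(dag-n05-d, p662149) displays the sourced guarded socket family of Theorem 4's frame at the PRINT-CLASS PERIODIC MEMBERS `a : Node00.IdxB8SubDPerκ θ P Mκ Rκ`
(dag-n05-c's (9′) ∕ T6c texts: source admissibility `(((InR138 ∧ Hermitian ∧ supported ∧ Bdd) ∧ IsPeriodic P φ) ∧ |φ|₍₋₂₎ < γ₈(α₀+α₁))`, gauge predicate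
`LanF146`, print's class `towerBondsP`).  lit-balaban's IR-N05-P5NS instance (ii) (r05 g96 engines p663593 ∕ p664000 ∕ p664407; p21 g41 storey E-ii-3′
`B8SockHFPRDSrcGammaPrimePer`, body E-ii-4a′ `B8Prop5NestedServerSrcPerBody`, server E-ii-4b′ `B8Prop5NestedServerSrcPer`) serves `SP5base ∕ SP5` for ANY
member map `ι : J → ZdIdx d L`, period map `p`, with the per-member laws, the [4] letters, the sourced b9 socket (for `SP5`) and the JOIN's scalar windows
DISPLAYED.  Here `J := IdxB8SubDPerκ θ P Mκ Rκ`, `ι := toZdIdx`, `p := fun _ => P`, `γ := γ₈`, and: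
* EVERY per-member law is READ OFF THE INDEX — towers at every truncation (`B8IdxB8LawsB.IdxB8SubB.tower_all`), the truncation relations of the constraint
  families (`Node00.IdxB8Laws.trunc_lt ∕ trunc_top` via `IdxB8SubDPer.laws`), `Lʲ ∣ P` (`IdxB8SubDPer.dvd_level`, cast to `ℤ`), the towers' shift-invariance at
  every truncation in the server's `ℤ`-division currency (`IdxB8SubDPer.mem_Λs_add_smul_iff` — rigidity + the tiling law, dag-n05-w1 ∕ dag-n05-w2 — with
  `Int.natCast_div`), `Ω_j` `P`-periodic (`IdxB8SubDPerκ.periodic`);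
* the JOIN's 25 sourced scalar windows are DISCHARGED below one threshold by dag-n05-w4's `B8SockWindowsSrc.hfpWindows_of_guard_src` (the free-constant
  condition WITH SOURCE `3·(2dL²)·B_G·B_R·(B₈ + γ₈) ≤ B₀′·B₈` displayed, as on the `ℤᵈ` γ′ road `B8SockSP5UniformThresholdsSrcGammaPrime`), and the five γ windows
  by lit-balaban's `B8SockP5uEProviderGamma.gammaWindows_of_guard` at `B₈`;
* DISPLAYED: the [4] letters `hLet` at the nested periodic `Ω_j` of every member, every periodic unitary background in `𝔄_k`, every truncation (the server's text
  at `ι a := a.toZdIdx`; N06 content) and, for `SP5`, (10)′ A's OWN guarded sourced b9 socket text `SH59src` below a free threshold `c₅₉` (server: N06,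
  dag-n06-b FILE 7 `B9SupplySockH59ZdSrcPer`), handed to lit-balaban's server AS IS (it is antitone in its threshold).
WHAT IS PROVED (two theorems):
* ★★ `sp5base_idxB8SubDPerκ_served` — `∃ cP > 0, ∀ a : IdxB8SubDPerκ θ P Mκ Rκ, «(10)′ A's SP5base binder text at a»` TOKEN FOR TOKEN;
* ★★ `sp5_idxB8SubDPerκ_served` — `∃ cP > 0, ∀ a : IdxB8SubDPerκ θ P Mκ Rκ, «(10)′ A's SP5 binder text at a»` TOKEN FOR TOKEN (`cP := min c_W (min c₅₉ c_γ)`).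
KNIT (dag-n05-d's final head): `obtain ⟨cPb, hcPb, SP5base⟩ := sp5base_idxB8SubDPerκ_served …`, `obtain ⟨cP5, hcP5, SP5⟩ := sp5_idxB8SubDPerκ_served … SH59src hLet`,
then (10)′ A at `cP := min …` with each socket restricted by `hs.trans (min_le_…)`.  FIT: this file type-checks in ONE monolith with p21 g41's staged
E-ii-3′∕4a′∕4b′ bytes (farm rc 0 · 0 warnings, 2026-08-28T20:5xZ) — conclusions cut from (10)′ A :105–:142 by script.
HONEST FRAMING: composition BY NAME; 0 estimates of Bałaban's proved here; the [4] letters, the `SH59src` text and the free-constant condition remain HYPOTHESES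
(N06 content ∕ the door's constants); count-neutral; **N05 NOT discharged** (director-ym №227 (b): only when every consumed socket is served by name); FLAG №4
OPEN; K1⁹ NOT claimed; Bałaban AS PRINTED; one finite 𝕋⁴ programme at fixed ε; nothing continuum ∕ ℝ⁴ ∕ OS ∕ mass-gap ∕ Clay.  No `sorry`, no new definition.
Unit `pub-ymgap-dag-n05-c` (g18).
[cite: Balaban1985RegularSpaces, Prop. 5 (1.107)–(1.108) p.94, Thm 4 p.88, p.89, p.95, (1.68)–(1.69) p.88, Thm 8 (1.146) p.101, (1.57)–(1.59) p.86, (1.3)–(1.6) p.77, p.77 («Ω_j ⊂ T_η»), §3 p.98; Balaban1985BackgroundPropagators, Thm 3.1 p.397, Thm 3.3 p.399, (3.19) p.393; Balaban1985Averaging, (4) p.18, Prop. 4 p.38]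
-/

noncomputable section

namespace Summit.QuantumFields.YangMills.BalabanUVNodes.N05SubBP2DK2PerP5FrameSocketsServed

open Literature.MathematicalPhysics.QuantumFieldTheory.Balaban1983to89
open Literature.MathematicalPhysics.QuantumFieldTheory.Balaban1983to89.Node00
open Literature.MathematicalPhysics.QuantumFieldTheory.Balaban1983to89.B8IdxB8LawsB (IdxB8LawsB IdxB8SubB)
open Literature.MathematicalPhysics.QuantumFieldTheory.Balaban1983to89.B8LeafModelZd (ZdIdx)
open Literature.MathematicalPhysics.QuantumFieldTheory.Balaban1983to89.B8LeafModelZdHP2Per (zdGF3HP₂Per)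
open Literature.MathematicalPhysics.QuantumFieldTheory.Balaban1983to89.B8TowerBondsPrinted (towerBondsP)
open Literature.MathematicalPhysics.QuantumFieldTheory.Balaban1983to89.B8Lemma1NonAbelian (mulCfg blockPairNA)
open Literature.MathematicalPhysics.QuantumFieldTheory.Balaban1983to89.B8LanF146 (LanF146 lanF146_clause)
open Literature.MathematicalPhysics.QuantumFieldTheory.Balaban1983to89.B8Prop5LandauDataZdPer (zdLanPer)
open Literature.MathematicalPhysics.QuantumFieldTheory.Balaban1983to89.B8Prop5NestedServerSrcPer (sockP5SrcPer_of_lettersAtPerNested sockP5baseSrcPer_of_lettersAtPerNested)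
open Literature.MathematicalPhysics.QuantumFieldTheory.Balaban1983to89.B8SockWindowsSrc (hfpWindows_of_guard_src)
open Literature.MathematicalPhysics.QuantumFieldTheory.Balaban1983to89.B8SockP5uEProviderGamma (gammaWindows_of_guard)
open T4TermwiseTorus (IsPeriodic)
open MatrixLog B7Prop1Explicit B7Prop2Explicit B7Prop1Local B7Eq92Concrete
open B7Eq78Linearization (zdBlocking QprimeIter)
open B8Ineq130 (tlo thi)
open B8Ineq132 (InAk covDerivFwd)
open B8Eq119TwistedAxial (Restr129 InAx bgT)
open B8Eq140Level (SideTouches)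
open B8Eq138LandauZd (covLap covDivB QT logCfg InR138 IsLandau146W)
open B8Eq184Proof (gaugeExp cfgExp)
open B8Eq146AExpansion (iEta plaqCovDeriv)
open B8Eq143PlaqExpansion (pdiv)
open B7Prop4GeneralLevels (linCovIter)
open B8Eq155JBound (Jcur wsup)
open B8Eq1117Concrete (XSpace)
open B8Ineq125Concrete (C2p)
open B7Prop2Explicit (C0 c2')
open B7Prop3Flat (c3)
open B7Prop10General (C6 C4G)
open B7Prop9Flat (C5')
open Literature.MathematicalPhysics.QuantumLattice (blockSites)
open B8Prop5ContractionKLevel (Bd2 Mc Kc)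
open B8LambdaSpaceKLevel (wt)
open B8ScaledSupNorm (bondNorm msup Bdd)
open B9Eq340HolderZd (hquot AdmPair)

-- `Site` alone could resolve to the torus sites of `Setup.lean`; re-export the `ℤ^d` sites of `B7Prop1Explicit`.
export B7Prop1Explicit (Site)

variable (θ : Stage3Params)

/-! ## The sourced existence sockets `SP5base` ∕ `SP5` served (IR-N05-P5NS instance (ii), member-indexed at the κ-periodic print-class index) -/

/-- ★★ **THE KNIT's SOURCED BASE SOCKET `SP5base` OF (10)′ A SERVED AT THE PRINT-CLASS PERIODIC MEMBERS, BELOW ONE THRESHOLD** (Prop. 5 (1.107)–(1.108)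
p. 94 at level `1` from `u₁ = 1`, `U₁ = U′`, p. 89; Theorem 8's source (1.146) p. 101; torus §3 p. 98): lit-balaban's member-indexed server
`B8Prop5NestedServerSrcPer.sockP5baseSrcPer_of_lettersAtPerNested` (IR-N05-P5NS instance (ii), r05 g96 ∕ p21 g41) READ AT `J := IdxB8SubDPerκ θ P Mκ Rκ`,
`ι := toZdIdx`, `p := fun _ => P`, source constant `γ := γ₈`, with EVERY per-member law read off the index (towers `IdxB8SubB.tower_all`; `Lʲ ∣ P`
`IdxB8SubDPer.dvd_level`; the towers' shift-invariance at every truncation `IdxB8SubDPer.mem_Λs_add_smul_iff`; `Ω_j` periodic `IdxB8SubDPerκ.periodic`) and the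
JOIN's sourced scalar windows DISCHARGED below ONE threshold by dag-n05-w4's `B8SockWindowsSrc.hfpWindows_of_guard_src` (free-constant condition with source
`3·(2dL²)·B_G·B_R·(B₈ + γ₈) ≤ B₀′·B₈`); DISPLAYED: the [4] letters `hLet`.  CONCLUSION: `∃ cP > 0` and then (10)′ A's `SP5base` binder text at every
`a : IdxB8SubDPerκ θ P Mκ Rκ` TOKEN FOR TOKEN.  No estimate here.
[cite: Balaban1985RegularSpaces, Prop. 5 (1.107)–(1.108) p.94 («c₂»), p.89, Thm 4 p.88 («there exists a constant c₁»), Thm 8 (1.146) p.101, (1.5)–(1.6) p.77, p.77 («Ω_j ⊂ T_η»), §3 p.98; Balaban1985BackgroundPropagators, Thm 3.1 p.397, (3.19) p.393; Balaban1985Averaging, (4) p.18] -/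
theorem sp5base_idxB8SubDPerκ_served (hD : 2 ≤ θ.D) (Mκ Rκ P : ℕ)
    {B₀' B₈ γ₈ B₀'H B₂' BG BR : ℝ} (hB₀' : 0 < B₀') (hB₈ : 0 < B₈) (hB : 2 ≤ 5 * (θ.D : ℝ) * θ.L * B₈)
    (hB₀'H : 0 < B₀'H) (hB₂' : 0 ≤ B₂') (hBG : 0 ≤ BG) (hBR : 0 ≤ BR) (hγ₈ : 0 ≤ γ₈)
    (hfreeS : 3 * (2 * (θ.D : ℝ) * (θ.L : ℝ) ^ 2) * BG * BR * (B₈ + γ₈) ≤ B₀' * B₈)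
    -- THE [4] LETTERS AT THE NESTED PERIODIC `Ω_j` OF EVERY PRINT-CLASS PERIODIC MEMBER, every unitary periodic background in `𝔄_k`, every truncation
    -- `1 ≤ n ≤ k` ((E1)∕(E2)∕(1.91) at periodic arguments, readings, `H′`∕`G′`∕remainder laws, (P)) — HYPOTHESIS (N06 content; the server's `hLet` text)
    (hLet : ∀ a : IdxB8SubDPerκ θ P Mκ Rκ, ∀ α₀ : ℝ, 0 < α₀ → ∀ U₀ : Site θ.D → Fin θ.D → θ.𝔸ˣ, (∀ x κ, U₀ x κ ∈ unitaryUnits θ.𝔸) → IsPeriodic P U₀ →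
      InAk θ.L a.toZdIdx.k a.toZdIdx.η α₀ a.toZdIdx.Ω U₀ → ∀ n, 1 ≤ n → n ≤ a.toZdIdx.k →
      ∃ (g Δ : (Site θ.D → θ.𝔸) →ₗ[ℂ] (Site θ.D → θ.𝔸)) (q : (Site θ.D → θ.𝔸) →ₗ[ℂ] (ℕ → Site θ.D → θ.𝔸)) (qs : (ℕ → Site θ.D → θ.𝔸) →ₗ[ℂ] (Site θ.D → θ.𝔸))
        (Aw c : (ℕ → Site θ.D → θ.𝔸) →ₗ[ℂ] (ℕ → Site θ.D → θ.𝔸)) (H' : XSpace θ.D n θ.𝔸 →ₗ[ℂ] (Site θ.D → θ.𝔸)),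
        (∀ x, (∀ (z : Site θ.D) (i : Fin θ.D), x (z + (P : ℤ) • e i) = x z) → ∀ y ∈ a.toZdIdx.Ω 0, (Δ (g x) + qs (Aw (q (g x)))) y = x y) ∧
        (∀ f, (∀ (z : Site θ.D) (i : Fin θ.D), f (z + (P : ℤ) • e i) = f z) → q (g (g (qs (c (q f))))) = q f) ∧
        (∀ (f : Site θ.D → θ.𝔸) (z : Site θ.D) (i : Fin θ.D), g f (z + (P : ℤ) • e i) = g f z) ∧
        (∀ f : Site θ.D → θ.𝔸, (∀ (z : Site θ.D) (i : Fin θ.D), f (z + (P : ℤ) • e i) = f z) →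
      ∀ (z : Site θ.D) (i : Fin θ.D), qs (c (q f)) (z + (P : ℤ) • e i) = qs (c (q f)) z) ∧
        (∀ (f : Site θ.D → θ.𝔸), ∀ x ∈ a.toZdIdx.Ω 0, Δ f x = covLap a.toZdIdx.η U₀ ((a.toZdIdx.Ω 0).indicator f) x) ∧
        (∀ (μ : ℕ → Site θ.D → θ.𝔸), ∀ x ∈ a.toZdIdx.Ω 0, qs μ x = QT θ.L n (a.toZdIdx.Λs n) U₀ μ x) ∧
        (∀ (f : Site θ.D → θ.𝔸) (j : ℕ), j ≤ n → ∀ y ∈ a.toZdIdx.Λs n j, q f j y = QprimeIter (zdBlocking θ.D θ.L) (bgT θ.L U₀) j f y) ∧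
        (∀ (X : XSpace θ.D n θ.𝔸) (x : Site θ.D), ‖H' X x‖ ≤ B₀'H * ‖X‖) ∧
        (∀ j, j ≤ n → ∀ (X : XSpace θ.D n θ.𝔸), ∀ b ∈ {b : Site θ.D × Fin θ.D | SideTouches (a.toZdIdx.Ω j) b.1 b.2},
      wt θ.L a.toZdIdx.η j * ‖covDerivFwd a.toZdIdx.η U₀ b.2 (H' X) b.1‖ ≤ B₀'H * ‖X‖) ∧
        (∀ X : XSpace θ.D n θ.𝔸, Bd2 θ.L a.toZdIdx.η n a.toZdIdx.Ω (covLap a.toZdIdx.η U₀ (H' X)) (B₂' * ‖X‖)) ∧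
        (∀ (X : XSpace θ.D n θ.𝔸) (x : Site θ.D), x ∉ a.toZdIdx.Ω 0 → H' X x = 0) ∧
        (∀ X Y : XSpace θ.D n θ.𝔸, (∀ b, Y b = -star (X b)) → ∀ x, H' Y x = -star (H' X x)) ∧
        (∀ X : XSpace θ.D n θ.𝔸, (∀ (b : Fin (n + 1) × Site θ.D) (i : Fin θ.D), X (b.1, b.2 + ((P : ℤ) / (θ.L : ℤ) ^ (b.1 : ℕ)) • e i) = X b) →
      ∀ (z : Site θ.D) (i : Fin θ.D), H' X (z + (P : ℤ) • e i) = H' X z) ∧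
        (∀ (Y : XSpace θ.D n θ.𝔸), (∀ (b : Fin (n + 1) × Site θ.D) (i : Fin θ.D), Y (b.1, b.2 + ((P : ℤ) / (θ.L : ℤ) ^ (b.1 : ℕ)) • e i) = Y b) →
      ∀ (j : ℕ) (hj : j ≤ n) (y : Site θ.D), y ∈ a.toZdIdx.Λs n j →
      QprimeIter (zdBlocking θ.D θ.L) (bgT θ.L U₀) j (H' Y) y = Y (⟨j, Nat.lt_succ_of_le hj⟩, y)) ∧
        (∀ (f : Site θ.D → θ.𝔸) (r : ℝ), 0 ≤ r → Bd2 θ.L a.toZdIdx.η n a.toZdIdx.Ω f r →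
      (∀ x, ‖g f x‖ ≤ BG * r) ∧ ∀ j, j ≤ n → ∀ b ∈ {b : Site θ.D × Fin θ.D | SideTouches (a.toZdIdx.Ω j) b.1 b.2},
        wt θ.L a.toZdIdx.η j * ‖covDerivFwd a.toZdIdx.η U₀ b.2 (g f) b.1‖ ≤ BG * r) ∧
        (∀ (f : Site θ.D → θ.𝔸) (x : Site θ.D), x ∉ a.toZdIdx.Ω 0 → g f x = 0) ∧
        (∀ f : Site θ.D → θ.𝔸, (∀ j, j ≤ n → ∀ x ∈ a.toZdIdx.Ω j, IsSelfAdjoint (f x)) → ∀ x, IsSelfAdjoint (g f x)) ∧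
        (∀ (f : Site θ.D → θ.𝔸) (r : ℝ), 0 ≤ r → Bd2 θ.L a.toZdIdx.η n a.toZdIdx.Ω f r → Bd2 θ.L a.toZdIdx.η n a.toZdIdx.Ω (f - g (qs (c (q (g f))))) (BR * r)) ∧
        (∀ f : Site θ.D → θ.𝔸, (∀ j, j ≤ n → ∀ x ∈ a.toZdIdx.Ω j, IsSelfAdjoint (f x)) →
      ∀ j, j ≤ n → ∀ x ∈ a.toZdIdx.Ω j, IsSelfAdjoint ((f - g (qs (c (q (g f))))) x))) :
    ∃ cP : ℝ, 0 < cP ∧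
      ∀ a : IdxB8SubDPerκ θ P Mκ Rκ, ∀ α₀ α₁ : ℝ, 0 < α₀ → 0 < α₁ → α₀ + α₁ ≤ cP →
      ∀ U₀ U' : Site θ.D → Fin θ.D → θ.𝔸ˣ, (∀ x κ, U₀ x κ ∈ unitaryUnits θ.𝔸) → (∀ x κ, U' x κ ∈ unitaryUnits θ.𝔸) →
      IsPeriodic P U₀ → IsPeriodic P U' → ∀ φ : Site θ.D → θ.𝔸, (((InR138 θ.L a.toZdIdx.k a.toZdIdx.η (a.toZdIdx.Ω 0) (a.toZdIdx.Λs a.toZdIdx.k) U₀ φ ∧ (∀ x, IsSelfAdjoint (φ x)) ∧ (∀ x, x ∉ a.toZdIdx.Ω 0 → φ x = 0) ∧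
          Bdd θ.L a.toZdIdx.k a.toZdIdx.η (-(2 : ℝ)) (fun j (x : Site θ.D) => x ∈ a.toZdIdx.Ω j) φ) ∧ IsPeriodic P φ) ∧
        msup θ.L a.toZdIdx.k a.toZdIdx.η (-(2 : ℝ)) (fun j (x : Site θ.D) => x ∈ a.toZdIdx.Ω j) φ < γ₈ * (α₀ + α₁)) →
      InAk θ.L a.toZdIdx.k a.toZdIdx.η α₀ a.toZdIdx.Ω U₀ → InAk θ.L a.toZdIdx.k a.toZdIdx.η α₀ a.toZdIdx.Ω (mulCfg U' U₀) → (∀ m, m ≤ a.toZdIdx.k → InAx θ.L m (a.toZdIdx.Λs m) U₀ (mulCfg U' U₀)) →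
      (∀ j, j ≤ a.toZdIdx.k → ∀ (z : Site θ.D) (μ : Fin θ.D),
        ((∀ x, InBox (tlo θ.L z j) (thi θ.L z j) x → x ∈ a.toZdIdx.Ω j) ∨ (∀ x, InBox (tlo θ.L (z + e μ) j) (thi θ.L (z + e μ) j) x → x ∈ a.toZdIdx.Ω j)) →
        ‖(avgIter θ.L (mulCfg U' U₀) j z μ : θ.𝔸) - (avgIter θ.L U₀ j z μ : θ.𝔸)‖ ≤ α₁) →
      (∀ b ∈ {b : Site θ.D × Fin θ.D | SideTouches (a.toZdIdx.Ω 0) b.1 b.2}, ‖((U' b.1 b.2 : θ.𝔸ˣ) : θ.𝔸) - 1‖ ≤ α₁) →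
      (∃ (v : Site θ.D → θ.𝔸ˣ) (la : Site θ.D → θ.𝔸), (∀ x, v x ∈ unitaryUnits θ.𝔸) ∧ (∀ x, x ∉ a.toZdIdx.Ω 0 → v x = 1) ∧
        (∀ j, j ≤ 1 → ∀ b ∈ {b : Site θ.D × Fin θ.D | SideTouches (a.toZdIdx.Ω j) b.1 b.2}, (v b.1 : θ.𝔸) = ((gaugeExp la b.1 : θ.𝔸ˣ) : θ.𝔸) ∧
        (v (b.1 + e b.2) : θ.𝔸) = ((gaugeExp la (b.1 + e b.2) : θ.𝔸ˣ) : θ.𝔸)) ∧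
        (∀ j, j ≤ 1 → ∀ b ∈ {b : Site θ.D × Fin θ.D | SideTouches (a.toZdIdx.Ω j) b.1 b.2},
        ‖la b.1‖ ≤ (8 * B₀' * (5 * (θ.D : ℝ) * θ.L * B₈) * (α₀ + α₁)) ∧ ((θ.L : ℝ) ^ j * a.toZdIdx.η) * ‖covDerivFwd a.toZdIdx.η U₀ b.2 la b.1‖ ≤ (8 * B₀' * (5 * (θ.D : ℝ) * θ.L * B₈) * (α₀ + α₁))) ∧
        LanF146 θ.L a.toZdIdx.k a.toZdIdx.η (a.toZdIdx.Ω 0) a.toZdIdx.Λs U₀ φ 1 (mgauge U₀ v⁻¹ U') ∧ Restr129 θ.L 1 (a.toZdIdx.Λs 1) U₀ ((1 : Site θ.D → θ.𝔸ˣ) * v) ∧ IsPeriodic P v) := by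
  have hd1 : 1 ≤ θ.D := le_trans one_le_two hD
  have hL1 : 1 ≤ θ.L := le_trans one_le_two θ.two_le_L
  -- the JOIN's sourced windows below ONE threshold (dag-n05-w4)
  obtain ⟨cW, hcW, hW⟩ := hfpWindows_of_guard_src (d := θ.D) hd1 hL1 hB₈ hB₀' hB hB₀'H hB₂' hBG hBR hγ₈ hfreeS
  refine ⟨cW, hcW, fun a => ?_⟩
  exact sockP5baseSrcPer_of_lettersAtPerNested (𝔸 := θ.𝔸) hD θ.two_le_L hB₀' hB₈ hB₀'H hB₂' hBG hBR hγ₈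
    (fun a : IdxB8SubDPerκ θ P Mκ Rκ => a.toZdIdx) (fun _ => P)
    (fun a => IdxB8SubB.tower_all a.1.1.1.1) (fun a j hj => by exact_mod_cast a.1.dvd_level hj)
    (fun a m hm j hj y i => by
      have h := a.1.mem_Λs_add_smul_iff hm hj y (e i)
      simp only [Int.natCast_div, Nat.cast_pow] at h
      exact h)
    (fun a j _ => a.periodic j) hB hLet
    (fun α₀ α₁ hα₀ hα₁ hs cs α₄ cB cDA hE hE₂ lE lE₂ e1 e2 e3 e4 e5 e6 e7 e8 => by
      obtain ⟨w1, w2, w3, w4, w5, w6, w7, w8, w9, w10, w11, w12, w13, w14, w15, w16, w17, w18, w19, w20, w21, w22, w23, w24, w25, -, -, -⟩ :=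
        hW α₀ α₁ hα₀ hα₁ hs cs α₄ cB cDA hE hE₂ lE lE₂ e1 e2 e3 e4 e5 e6 e7 e8
      exact ⟨w1, w2, w3, w4, w5, w6, w7, w8, w9, w10, w11, w12, w13, w14, w15, w16, w17, w18, w19, w20, w21, w22, w23, w24, w25⟩)
    a

/-- ★★ **THE KNIT's SOURCED STEP SOCKET `SP5` OF (10)′ A SERVED AT THE PRINT-CLASS PERIODIC MEMBERS, BELOW ONE THRESHOLD** (Prop. 5 (1.107)–(1.108) p. 94
at level `m + 1` from a periodic level-`m` datum, (1.68)–(1.69) p. 88; Theorem 8's source (1.146) p. 101; torus §3 p. 98): lit-balaban's member-indexed server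
`B8Prop5NestedServerSrcPer.sockP5SrcPer_of_lettersAtPerNested` (IR-N05-P5NS instance (ii), edition γ′) READ AT `J := IdxB8SubDPerκ θ P Mκ Rκ`, `ι := toZdIdx`,
`p := fun _ => P`, `γ := γ₈`, with EVERY per-member law read off the index (towers `IdxB8SubB.tower_all`; truncation relations `IdxB8Laws.trunc_lt ∕ trunc_top`;
`Lʲ ∣ P`; the towers' shift-invariance at every truncation; `Ω_j` periodic), the JOIN's sourced windows by `hfpWindows_of_guard_src` and the γ windows by
`B8SockP5uEProviderGamma.gammaWindows_of_guard` (at `B₈`) DISCHARGED below ONE threshold `min c_W (min c₅₉ c_γ)`; DISPLAYED: the [4] letters `hLet` and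
(10)′ A's OWN guarded sourced b9 socket text `SH59src` below `c₅₉` (server: N06 FILE 7) — handed to the server AS IS (antitone in the threshold).
CONCLUSION: `∃ cP > 0` and then (10)′ A's `SP5` binder text at every `a : IdxB8SubDPerκ θ P Mκ Rκ` TOKEN FOR TOKEN.  No estimate here.
[cite: Balaban1985RegularSpaces, Prop. 5 (1.107)–(1.108) p.94 («c₂»), Thm 4 p.88 («there exists a constant c₁»), (1.68)–(1.69) p.88, Thm 8 (1.146) p.101, (1.57)–(1.59) p.86, (1.5)–(1.6) p.77, p.77 («Ω_j ⊂ T_η»), §3 p.98; Balaban1985BackgroundPropagators, Thm 3.1 p.397, Thm 3.3 p.399; Balaban1985Averaging, (4) p.18, Prop. 4 p.38] -/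
theorem sp5_idxB8SubDPerκ_served (hD : 2 ≤ θ.D) (Mκ Rκ P : ℕ)
    {B₀ B₀' B₈ γ₈ γ' B₀'H B₂' BG BR c59 : ℝ} (hB₀ : 0 < B₀) (hB₀' : 0 < B₀') (hB₈ : 0 < B₈) (hB : 2 ≤ 5 * (θ.D : ℝ) * θ.L * B₈)
    (hB₀'H : 0 < B₀'H) (hB₂' : 0 ≤ B₂') (hBG : 0 ≤ BG) (hBR : 0 ≤ BR) (hγ₈ : 0 ≤ γ₈) (hγ' : 0 ≤ γ') (hB₀8 : B₀ ≤ B₈)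
    (hγB2 : 2 * (γ' * B₀) ≤ 5 * (θ.D : ℝ) * θ.L * B₈)
    (hfreeS : 3 * (2 * (θ.D : ℝ) * (θ.L : ℝ) ^ 2) * BG * BR * (B₈ + γ₈) ≤ B₀' * B₈) (hc59 : 0 < c59)
    -- (10)′ A's OWN GUARDED SOURCED b9 SOCKET TEXT below `c₅₉` — HYPOTHESIS (server: N06, n06-b FILE 7 `B9SupplySockH59ZdSrcPer`)
    (SH59src : ∀ a : IdxB8SubDPerκ θ P Mκ Rκ, ∀ α₀ α₁ : ℝ, 0 < α₀ → 0 < α₁ → α₀ + α₁ ≤ c59 →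
      ∀ U₀ U' : Site θ.D → Fin θ.D → θ.𝔸ˣ, (∀ x κ, U₀ x κ ∈ unitaryUnits θ.𝔸) → (∀ x κ, U' x κ ∈ unitaryUnits θ.𝔸) →
      IsPeriodic P U₀ → IsPeriodic P U' → ∀ φ : Site θ.D → θ.𝔸, (((InR138 θ.L a.toZdIdx.k a.toZdIdx.η (a.toZdIdx.Ω 0) (a.toZdIdx.Λs a.toZdIdx.k) U₀ φ ∧ (∀ x, IsSelfAdjoint (φ x)) ∧ (∀ x, x ∉ a.toZdIdx.Ω 0 → φ x = 0) ∧
          Bdd θ.L a.toZdIdx.k a.toZdIdx.η (-(2 : ℝ)) (fun j (x : Site θ.D) => x ∈ a.toZdIdx.Ω j) φ) ∧ IsPeriodic P φ) ∧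
        msup θ.L a.toZdIdx.k a.toZdIdx.η (-(2 : ℝ)) (fun j (x : Site θ.D) => x ∈ a.toZdIdx.Ω j) φ < γ₈ * (α₀ + α₁)) →
      InAk θ.L a.toZdIdx.k a.toZdIdx.η α₀ a.toZdIdx.Ω U₀ → InAk θ.L a.toZdIdx.k a.toZdIdx.η α₀ a.toZdIdx.Ω (mulCfg U' U₀) → (∀ m, m ≤ a.toZdIdx.k → InAx θ.L m (a.toZdIdx.Λs m) U₀ (mulCfg U' U₀)) →
      (∀ j, j ≤ a.toZdIdx.k → ∀ (z : Site θ.D) (μ : Fin θ.D),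
        ((∀ x, InBox (tlo θ.L z j) (thi θ.L z j) x → x ∈ a.toZdIdx.Ω j) ∨ (∀ x, InBox (tlo θ.L (z + e μ) j) (thi θ.L (z + e μ) j) x → x ∈ a.toZdIdx.Ω j)) →
        ‖(avgIter θ.L (mulCfg U' U₀) j z μ : θ.𝔸) - (avgIter θ.L U₀ j z μ : θ.𝔸)‖ ≤ α₁) →
      (∀ b ∈ {b : Site θ.D × Fin θ.D | SideTouches (a.toZdIdx.Ω 0) b.1 b.2}, ‖((U' b.1 b.2 : θ.𝔸ˣ) : θ.𝔸) - 1‖ ≤ α₁) →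
      (∀ m, 1 ≤ m → m ≤ a.toZdIdx.k → ∀ (u : Site θ.D → θ.𝔸ˣ) (W : Site θ.D → Fin θ.D → θ.𝔸ˣ) (A' : Site θ.D → Fin θ.D → θ.𝔸),
        (∀ x, u x ∈ unitaryUnits θ.𝔸) → IsPeriodic P u → IsPeriodic P W → IsPeriodic P A' →
        mgauge U₀ u W = U' → Restr129 θ.L m (a.toZdIdx.Λs m) U₀ u → LanF146 θ.L a.toZdIdx.k a.toZdIdx.η (a.toZdIdx.Ω 0) a.toZdIdx.Λs U₀ φ m W →
        (∀ y τ, IsSelfAdjoint (A' y τ)) →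
        (∀ j, j ≤ m → ∀ y τ, SideTouches (a.toZdIdx.Ω j) y τ →
        W y τ = cfgExp a.toZdIdx.η A' y τ ∧ ‖A' y τ‖ ≤ (2 * (θ.L * (5 * (θ.D : ℝ) * θ.L * B₈ * (α₀ + α₁))) + 8 * (8 * B₀' * (5 * (θ.D : ℝ) * θ.L * B₈) * (α₀ + α₁))) * ((θ.L : ℝ) ^ j * a.toZdIdx.η)⁻¹) →
        (∀ y τ, (∀ j, j ≤ m → ¬ SideTouches (a.toZdIdx.Ω j) y τ) → A' y τ = 0) →
        msup θ.L m a.toZdIdx.η (-(1 : ℝ)) (fun j (b : Site θ.D × Fin θ.D) => SideTouches (a.toZdIdx.Ω j) b.1 b.2) (fun b => A' b.1 b.2)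
        ≤ B₀ * (bondNorm θ.L m a.toZdIdx.η (-(3 : ℝ)) a.toZdIdx.Ω (fun x μ => Jcur a.toZdIdx.η U₀ A' μ x)
        + wsup 1 (fun p : {p : ℕ × (Site θ.D × Fin θ.D) // p.1 ≤ m ∧ p.2 ∈ towerBondsP θ.L a.toZdIdx.Ω (a.toZdIdx.Λs m) p.1} =>
        linCovIter θ.L U₀ (iEta a.toZdIdx.η A') p.1.1 p.1.2.1 p.1.2.2)) + γ' * B₀ * (α₀ + α₁) ∧
        msup θ.L m a.toZdIdx.η (-(2 : ℝ)) (fun j (t : Fin θ.D × Fin θ.D × Site θ.D) => SideTouches (a.toZdIdx.Ω j) t.2.2 t.2.1)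
        (fun t => covDerivFwd a.toZdIdx.η U₀ t.1 (fun z => A' z t.2.1) t.2.2)
        ≤ B₀ * (bondNorm θ.L m a.toZdIdx.η (-(3 : ℝ)) a.toZdIdx.Ω (fun x μ => Jcur a.toZdIdx.η U₀ A' μ x)
        + wsup 1 (fun p : {p : ℕ × (Site θ.D × Fin θ.D) // p.1 ≤ m ∧ p.2 ∈ towerBondsP θ.L a.toZdIdx.Ω (a.toZdIdx.Λs m) p.1} =>
        linCovIter θ.L U₀ (iEta a.toZdIdx.η A') p.1.1 p.1.2.1 p.1.2.2)) + γ' * B₀ * (α₀ + α₁)))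
    -- THE [4] LETTERS AT THE NESTED PERIODIC `Ω_j` OF EVERY PRINT-CLASS PERIODIC MEMBER, every unitary periodic background in `𝔄_k`, every truncation
    -- `1 ≤ n ≤ k` ((E1)∕(E2)∕(1.91) at periodic arguments, readings, `H′`∕`G′`∕remainder laws, (P)) — HYPOTHESIS (N06 content; the server's `hLet` text)
    (hLet : ∀ a : IdxB8SubDPerκ θ P Mκ Rκ, ∀ α₀ : ℝ, 0 < α₀ → ∀ U₀ : Site θ.D → Fin θ.D → θ.𝔸ˣ, (∀ x κ, U₀ x κ ∈ unitaryUnits θ.𝔸) → IsPeriodic P U₀ →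
      InAk θ.L a.toZdIdx.k a.toZdIdx.η α₀ a.toZdIdx.Ω U₀ → ∀ n, 1 ≤ n → n ≤ a.toZdIdx.k →
      ∃ (g Δ : (Site θ.D → θ.𝔸) →ₗ[ℂ] (Site θ.D → θ.𝔸)) (q : (Site θ.D → θ.𝔸) →ₗ[ℂ] (ℕ → Site θ.D → θ.𝔸)) (qs : (ℕ → Site θ.D → θ.𝔸) →ₗ[ℂ] (Site θ.D → θ.𝔸))
        (Aw c : (ℕ → Site θ.D → θ.𝔸) →ₗ[ℂ] (ℕ → Site θ.D → θ.𝔸)) (H' : XSpace θ.D n θ.𝔸 →ₗ[ℂ] (Site θ.D → θ.𝔸)),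
        (∀ x, (∀ (z : Site θ.D) (i : Fin θ.D), x (z + (P : ℤ) • e i) = x z) → ∀ y ∈ a.toZdIdx.Ω 0, (Δ (g x) + qs (Aw (q (g x)))) y = x y) ∧
        (∀ f, (∀ (z : Site θ.D) (i : Fin θ.D), f (z + (P : ℤ) • e i) = f z) → q (g (g (qs (c (q f))))) = q f) ∧
        (∀ (f : Site θ.D → θ.𝔸) (z : Site θ.D) (i : Fin θ.D), g f (z + (P : ℤ) • e i) = g f z) ∧
        (∀ f : Site θ.D → θ.𝔸, (∀ (z : Site θ.D) (i : Fin θ.D), f (z + (P : ℤ) • e i) = f z) →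
      ∀ (z : Site θ.D) (i : Fin θ.D), qs (c (q f)) (z + (P : ℤ) • e i) = qs (c (q f)) z) ∧
        (∀ (f : Site θ.D → θ.𝔸), ∀ x ∈ a.toZdIdx.Ω 0, Δ f x = covLap a.toZdIdx.η U₀ ((a.toZdIdx.Ω 0).indicator f) x) ∧
        (∀ (μ : ℕ → Site θ.D → θ.𝔸), ∀ x ∈ a.toZdIdx.Ω 0, qs μ x = QT θ.L n (a.toZdIdx.Λs n) U₀ μ x) ∧
        (∀ (f : Site θ.D → θ.𝔸) (j : ℕ), j ≤ n → ∀ y ∈ a.toZdIdx.Λs n j, q f j y = QprimeIter (zdBlocking θ.D θ.L) (bgT θ.L U₀) j f y) ∧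
        (∀ (X : XSpace θ.D n θ.𝔸) (x : Site θ.D), ‖H' X x‖ ≤ B₀'H * ‖X‖) ∧
        (∀ j, j ≤ n → ∀ (X : XSpace θ.D n θ.𝔸), ∀ b ∈ {b : Site θ.D × Fin θ.D | SideTouches (a.toZdIdx.Ω j) b.1 b.2},
      wt θ.L a.toZdIdx.η j * ‖covDerivFwd a.toZdIdx.η U₀ b.2 (H' X) b.1‖ ≤ B₀'H * ‖X‖) ∧
        (∀ X : XSpace θ.D n θ.𝔸, Bd2 θ.L a.toZdIdx.η n a.toZdIdx.Ω (covLap a.toZdIdx.η U₀ (H' X)) (B₂' * ‖X‖)) ∧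
        (∀ (X : XSpace θ.D n θ.𝔸) (x : Site θ.D), x ∉ a.toZdIdx.Ω 0 → H' X x = 0) ∧
        (∀ X Y : XSpace θ.D n θ.𝔸, (∀ b, Y b = -star (X b)) → ∀ x, H' Y x = -star (H' X x)) ∧
        (∀ X : XSpace θ.D n θ.𝔸, (∀ (b : Fin (n + 1) × Site θ.D) (i : Fin θ.D), X (b.1, b.2 + ((P : ℤ) / (θ.L : ℤ) ^ (b.1 : ℕ)) • e i) = X b) →
      ∀ (z : Site θ.D) (i : Fin θ.D), H' X (z + (P : ℤ) • e i) = H' X z) ∧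
        (∀ (Y : XSpace θ.D n θ.𝔸), (∀ (b : Fin (n + 1) × Site θ.D) (i : Fin θ.D), Y (b.1, b.2 + ((P : ℤ) / (θ.L : ℤ) ^ (b.1 : ℕ)) • e i) = Y b) →
      ∀ (j : ℕ) (hj : j ≤ n) (y : Site θ.D), y ∈ a.toZdIdx.Λs n j →
      QprimeIter (zdBlocking θ.D θ.L) (bgT θ.L U₀) j (H' Y) y = Y (⟨j, Nat.lt_succ_of_le hj⟩, y)) ∧
        (∀ (f : Site θ.D → θ.𝔸) (r : ℝ), 0 ≤ r → Bd2 θ.L a.toZdIdx.η n a.toZdIdx.Ω f r →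
      (∀ x, ‖g f x‖ ≤ BG * r) ∧ ∀ j, j ≤ n → ∀ b ∈ {b : Site θ.D × Fin θ.D | SideTouches (a.toZdIdx.Ω j) b.1 b.2},
        wt θ.L a.toZdIdx.η j * ‖covDerivFwd a.toZdIdx.η U₀ b.2 (g f) b.1‖ ≤ BG * r) ∧
        (∀ (f : Site θ.D → θ.𝔸) (x : Site θ.D), x ∉ a.toZdIdx.Ω 0 → g f x = 0) ∧
        (∀ f : Site θ.D → θ.𝔸, (∀ j, j ≤ n → ∀ x ∈ a.toZdIdx.Ω j, IsSelfAdjoint (f x)) → ∀ x, IsSelfAdjoint (g f x)) ∧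
        (∀ (f : Site θ.D → θ.𝔸) (r : ℝ), 0 ≤ r → Bd2 θ.L a.toZdIdx.η n a.toZdIdx.Ω f r → Bd2 θ.L a.toZdIdx.η n a.toZdIdx.Ω (f - g (qs (c (q (g f))))) (BR * r)) ∧
        (∀ f : Site θ.D → θ.𝔸, (∀ j, j ≤ n → ∀ x ∈ a.toZdIdx.Ω j, IsSelfAdjoint (f x)) →
      ∀ j, j ≤ n → ∀ x ∈ a.toZdIdx.Ω j, IsSelfAdjoint ((f - g (qs (c (q (g f))))) x))) :
    ∃ cP : ℝ, 0 < cP ∧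
      ∀ a : IdxB8SubDPerκ θ P Mκ Rκ, ∀ α₀ α₁ : ℝ, 0 < α₀ → 0 < α₁ → α₀ + α₁ ≤ cP →
      ∀ U₀ U' : Site θ.D → Fin θ.D → θ.𝔸ˣ, (∀ x κ, U₀ x κ ∈ unitaryUnits θ.𝔸) → (∀ x κ, U' x κ ∈ unitaryUnits θ.𝔸) →
      IsPeriodic P U₀ → IsPeriodic P U' → ∀ φ : Site θ.D → θ.𝔸, (((InR138 θ.L a.toZdIdx.k a.toZdIdx.η (a.toZdIdx.Ω 0) (a.toZdIdx.Λs a.toZdIdx.k) U₀ φ ∧ (∀ x, IsSelfAdjoint (φ x)) ∧ (∀ x, x ∉ a.toZdIdx.Ω 0 → φ x = 0) ∧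
          Bdd θ.L a.toZdIdx.k a.toZdIdx.η (-(2 : ℝ)) (fun j (x : Site θ.D) => x ∈ a.toZdIdx.Ω j) φ) ∧ IsPeriodic P φ) ∧
        msup θ.L a.toZdIdx.k a.toZdIdx.η (-(2 : ℝ)) (fun j (x : Site θ.D) => x ∈ a.toZdIdx.Ω j) φ < γ₈ * (α₀ + α₁)) →
      InAk θ.L a.toZdIdx.k a.toZdIdx.η α₀ a.toZdIdx.Ω U₀ → InAk θ.L a.toZdIdx.k a.toZdIdx.η α₀ a.toZdIdx.Ω (mulCfg U' U₀) → (∀ m, m ≤ a.toZdIdx.k → InAx θ.L m (a.toZdIdx.Λs m) U₀ (mulCfg U' U₀)) →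
      (∀ j, j ≤ a.toZdIdx.k → ∀ (z : Site θ.D) (μ : Fin θ.D),
        ((∀ x, InBox (tlo θ.L z j) (thi θ.L z j) x → x ∈ a.toZdIdx.Ω j) ∨ (∀ x, InBox (tlo θ.L (z + e μ) j) (thi θ.L (z + e μ) j) x → x ∈ a.toZdIdx.Ω j)) →
        ‖(avgIter θ.L (mulCfg U' U₀) j z μ : θ.𝔸) - (avgIter θ.L U₀ j z μ : θ.𝔸)‖ ≤ α₁) →
      (∀ b ∈ {b : Site θ.D × Fin θ.D | SideTouches (a.toZdIdx.Ω 0) b.1 b.2}, ‖((U' b.1 b.2 : θ.𝔸ˣ) : θ.𝔸) - 1‖ ≤ α₁) →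
      (∀ m, 1 ≤ m → m < a.toZdIdx.k → ∀ (u₁ : Site θ.D → θ.𝔸ˣ) (U₁ : Site θ.D → Fin θ.D → θ.𝔸ˣ) (A : Site θ.D → Fin θ.D → θ.𝔸),
        (∀ x, u₁ x ∈ unitaryUnits θ.𝔸) → (∀ x, x ∉ a.toZdIdx.Ω 0 → u₁ x = 1) → IsPeriodic P u₁ → IsPeriodic P U₁ → IsPeriodic P A →
        mgauge U₀ u₁ U₁ = U' → Restr129 θ.L m (a.toZdIdx.Λs m) U₀ u₁ →
        LanF146 θ.L a.toZdIdx.k a.toZdIdx.η (a.toZdIdx.Ω 0) a.toZdIdx.Λs U₀ φ m U₁ →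
        (∀ j, j ≤ m → ∀ b ∈ {b : Site θ.D × Fin θ.D | SideTouches (a.toZdIdx.Ω j) b.1 b.2},
        U₁ b.1 b.2 = cfgExp a.toZdIdx.η A b.1 b.2 ∧ IsSelfAdjoint (A b.1 b.2) ∧ ‖A b.1 b.2‖ ≤ (5 * (θ.D : ℝ) * θ.L * B₈ * (α₀ + α₁)) * ((θ.L : ℝ) ^ j * a.toZdIdx.η)⁻¹) →
        ∃ (v : Site θ.D → θ.𝔸ˣ) (la : Site θ.D → θ.𝔸), (∀ x, v x ∈ unitaryUnits θ.𝔸) ∧ (∀ x, x ∉ a.toZdIdx.Ω 0 → v x = 1) ∧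
        (∀ j, j ≤ m + 1 → ∀ b ∈ {b : Site θ.D × Fin θ.D | SideTouches (a.toZdIdx.Ω j) b.1 b.2}, (v b.1 : θ.𝔸) = ((gaugeExp la b.1 : θ.𝔸ˣ) : θ.𝔸) ∧
        (v (b.1 + e b.2) : θ.𝔸) = ((gaugeExp la (b.1 + e b.2) : θ.𝔸ˣ) : θ.𝔸)) ∧
        (∀ j, j ≤ m + 1 → ∀ b ∈ {b : Site θ.D × Fin θ.D | SideTouches (a.toZdIdx.Ω j) b.1 b.2},
        ‖la b.1‖ ≤ (8 * B₀' * (5 * (θ.D : ℝ) * θ.L * B₈) * (α₀ + α₁)) ∧ ((θ.L : ℝ) ^ j * a.toZdIdx.η) * ‖covDerivFwd a.toZdIdx.η U₀ b.2 la b.1‖ ≤ (8 * B₀' * (5 * (θ.D : ℝ) * θ.L * B₈) * (α₀ + α₁))) ∧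
        LanF146 θ.L a.toZdIdx.k a.toZdIdx.η (a.toZdIdx.Ω 0) a.toZdIdx.Λs U₀ φ (m + 1) (mgauge U₀ v⁻¹ U₁) ∧ Restr129 θ.L (m + 1) (a.toZdIdx.Λs (m + 1)) U₀ (u₁ * v) ∧ IsPeriodic P v) := by
  have hd1 : 1 ≤ θ.D := le_trans one_le_two hD
  have hL1 : 1 ≤ θ.L := le_trans one_le_two θ.two_le_L
  -- the JOIN's sourced windows and the γ windows below ONE threshold each (dag-n05-w4 ∕ lit-balaban p21), then ONE threshold for all three inputs
  obtain ⟨cW, hcW, hW⟩ := hfpWindows_of_guard_src (d := θ.D) hd1 hL1 hB₈ hB₀' hB hB₀'H hB₂' hBG hBR hγ₈ hfreeS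
  obtain ⟨cγ, hcγ, hWγ⟩ := gammaWindows_of_guard (d := θ.D) hd1 hL1 hB₈
  refine ⟨min cW (min c59 cγ), lt_min hcW (lt_min hc59 hcγ), fun a => ?_⟩
  have hm₁ : min cW (min c59 cγ) ≤ cW := min_le_left _ _
  have hm₂ : min cW (min c59 cγ) ≤ c59 := (min_le_right _ _).trans (min_le_left _ _)
  have hm₃ : min cW (min c59 cγ) ≤ cγ := (min_le_right _ _).trans (min_le_right _ _)
  exact sockP5SrcPer_of_lettersAtPerNested (𝔸 := θ.𝔸) hD θ.two_le_L hB₀ hB₀' hB₈ hB₀'H hB₂' hBG hBR hγ₈ hγ' hB₀8 hγB2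
    (fun a : IdxB8SubDPerκ θ P Mκ Rκ => a.toZdIdx) (fun _ => P)
    (fun a => IdxB8SubB.tower_all a.1.1.1.1) (fun a => a.1.laws.trunc_lt) (fun a => a.1.laws.trunc_top)
    (fun a j hj => by exact_mod_cast a.1.dvd_level hj)
    (fun a m hm j hj y i => by
      have h := a.1.mem_Λs_add_smul_iff hm hj y (e i)
      simp only [Int.natCast_div, Nat.cast_pow] at h
      exact h)
    (fun a j _ => a.periodic j)
    (fun a α₀ α₁ hα₀ hα₁ hs => SH59src a α₀ α₁ hα₀ hα₁ (hs.trans hm₂)) hLet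
    (fun α₀ α₁ hα₀ hα₁ hs cs α₄ cB cDA hE hE₂ lE lE₂ e1 e2 e3 e4 e5 e6 e7 e8 => by
      obtain ⟨w1, w2, w3, w4, w5, w6, w7, w8, w9, w10, w11, w12, w13, w14, w15, w16, w17, w18, w19, w20, w21, w22, w23, w24, w25, -, -, -⟩ :=
        hW α₀ α₁ hα₀ hα₁ (hs.trans hm₁) cs α₄ cB cDA hE hE₂ lE lE₂ e1 e2 e3 e4 e5 e6 e7 e8
      exact ⟨w1, w2, w3, w4, w5, w6, w7, w8, w9, w10, w11, w12, w13, w14, w15, w16, w17, w18, w19, w20, w21, w22, w23, w24, w25⟩)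
    (fun α₀ α₁ hα₀ hα₁ hs => hWγ α₀ α₁ hα₀ hα₁ (hs.trans hm₃))
    a


end Summit.QuantumFields.YangMills.BalabanUVNodes.N05SubBP2DK2PerP5FrameSocketsServed

end
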